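import Mathlib

/-!
# Sector gap from the imaginary part (Lax–Milgram at zero for leaf-oscillating components)

Solo-blind paper §24.17(8′), sector (ii): after Floquet conjugation the leaf-oscillating components
(θ-Fourier index `k ≠ 0`) of the linearised steady operator have symbol `σ(c) − K₀ − i k Ω(c) + h²γ∂²_c`,
whose quadratic form has imaginary part `≤ −k Ω_min ‖v‖²` uniformly in the thin-box parameter `n`.
The abstract fact used there: an operator whose form has imaginary part bounded away from zero is
bounded below (hence injective, and in finite dimension invertible) with the RECIPROCAL GAP as the
constant — independent of every other feature of the operator (non-normality, small diffusion `h²`).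
Elementary; recorded as the typed mechanism behind the claimed n-uniformity of that sector.
-/

namespace Summit.AnomalousDissipation.AnomalousDissipation.Theorems

open scoped InnerProductSpace
open RCLike

variable {E : Type*} [NormedAddCommGroup E] [InnerProductSpace ℂ E]

/-- **Gap from the imaginary part.** If `Im ⟪v, M v⟫ ≤ -δ ‖v‖²` for all `v` with `δ > 0`, then
`δ ‖v‖ ≤ ‖M v‖` for all `v`: the operator is bounded below by the gap, whatever its real part. -/
theorem gap_le_norm_of_im_inner_le (M : E →L[ℂ] E) {δ : ℝ} (hδ : 0 < δ)
    (h : ∀ v : E, (⟪v, M v⟫_ℂ).im ≤ -δ * ‖v‖ ^ 2) (v : E) : δ * ‖v‖ ≤ ‖M v‖ := by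
  have h1 : δ * ‖v‖ ^ 2 ≤ ‖v‖ * ‖M v‖ := by
    have hv := h v
    have habs : |(⟪v, M v⟫_ℂ).im| ≤ ‖⟪v, M v⟫_ℂ‖ := Complex.abs_im_le_norm _
    have hcs : ‖⟪v, M v⟫_ℂ‖ ≤ ‖v‖ * ‖M v‖ := norm_inner_le_norm v (M v)
    have : δ * ‖v‖ ^ 2 ≤ |(⟪v, M v⟫_ℂ).im| := by
      rw [abs_of_nonpos (by nlinarith [norm_nonneg v, sq_nonneg ‖v‖])]
      linarith
    linarith
  by_cases hv0 : v = 0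
  · subst hv0; simp
  · have hpos : 0 < ‖v‖ := norm_pos_iff.mpr hv0
    have : δ * ‖v‖ * ‖v‖ ≤ ‖M v‖ * ‖v‖ := by nlinarith
    exact le_of_mul_le_mul_right this hpos

/-- Consequently such an operator is injective. -/
theorem injective_of_im_inner_le (M : E →L[ℂ] E) {δ : ℝ} (hδ : 0 < δ)
    (h : ∀ v : E, (⟪v, M v⟫_ℂ).im ≤ -δ * ‖v‖ ^ 2) : Function.Injective M := by
  intro v w hvw
  have key := gap_le_norm_of_im_inner_le M hδ h (v - w)
  rw [map_sub, hvw, sub_self, norm_zero] at key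
  have : ‖v - w‖ ≤ 0 := by nlinarith [norm_nonneg (v - w)]
  exact sub_eq_zero.mp (norm_le_zero_iff.mp this)

/-- The same with the opposite sign convention (`Im ⟪v, M v⟫ ≥ δ ‖v‖²`). -/
theorem gap_le_norm_of_le_im_inner (M : E →L[ℂ] E) {δ : ℝ} (hδ : 0 < δ)
    (h : ∀ v : E, δ * ‖v‖ ^ 2 ≤ (⟪v, M v⟫_ℂ).im) (v : E) : δ * ‖v‖ ≤ ‖M v‖ := by
  have h' : ∀ u : E, (⟪u, (-M) u⟫_ℂ).im ≤ -δ * ‖u‖ ^ 2 := by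
    intro u
    simp only [neg_apply, inner_neg_right, Complex.neg_im]
    linarith [h u]
  have := gap_le_norm_of_im_inner_le (-M) hδ h' v
  simpa using this

/-- Finite-dimensional form (the discretised sector): bounded below ⇒ a two-sided inverse exists,
and the solution of `M v = g` obeys `‖v‖ ≤ ‖g‖ / δ` — the n-uniform sector bound of §24.17(8′)(ii). -/
theorem solution_norm_le_of_im_inner_le [FiniteDimensional ℂ E] (M : E →L[ℂ] E) {δ : ℝ}
    (hδ : 0 < δ) (h : ∀ v : E, (⟪v, M v⟫_ℂ).im ≤ -δ * ‖v‖ ^ 2) (g : E) :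
    ∃ v : E, M v = g ∧ ‖v‖ ≤ ‖g‖ / δ := by
  have hinj := injective_of_im_inner_le M hδ h
  have hsurj : Function.Surjective M := by
    have := LinearMap.injective_iff_surjective (f := (M : E →ₗ[ℂ] E))
    exact this.mp hinj
  obtain ⟨v, hv⟩ := hsurj g
  refine ⟨v, hv, ?_⟩
  rw [le_div_iff₀ hδ, mul_comm]
  have := gap_le_norm_of_im_inner_le M hδ h v
  rwa [hv] at this

end Summit.AnomalousDissipation.AnomalousDissipation.Theorems
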